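import Literature.NumberTheory.ComplexMultiplication.EllipticUnits.ImaginaryQuadraticMainConjectureClassGroupRowLocal
import HarnessLib

/-!
# Plug (π3) of ROW 1 ASSEMBLED: every everywhere-unramified (strict above `p`) class `s` of `H¹(K̃_∞, (F/𝓞)(θ))` has `2·s`
# in the image of some layer `Ш¹_S(K̃_n, (ℤ/p^k)(θ)) → H¹(K̃_∞, (F/𝓞)(θ))` (Johnson-Leung–Kings 2011 Lemma 5.8, `Ш¹`-side)

Topic `Literature/NumberTheory/ComplexMultiplication/EllipticUnits` (grouping sub-namespace `JohnsonLeungKings2011.ClassGroupRow`).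
Cell `bsd-print-cf2`, width seat `bsd-line-cf2c-w8` g8.  THEOREMS ONLY (no definition, no named fact, no instance, no `sorry`).

* §1 local tower bookkeeping at a finite place `v`: `mem_of_toUnramifiedQuot_mem_map`, `exists_localLayer_subset` (cofinality of
  `Λ_n = φ_v⁻¹(V̄_n)` over `Λ_∞ = res_v⁻¹ Gal(K̄/K̃_∞)`), `isOpen_setOf_locRep_apply_eq`, `exists_resLe_loc_eq_zero` (Serre I §2.2 Prop. 8 for
  the local tower: a local layer class dying on `Λ_∞` dies on a deeper local layer);
* §2 `toSubgroupH1_eq_resOfLe_of_descend` — the comparison image of a descended layer cocycle;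
* §4 `two_nsmul_eq_zero_of_forall_toDual_iota_eq_zero` — hence a character of `H¹_{unr}` killing every `ι_{n,k}`-image is `2`-torsion
  (`hfker` with `r = 2` for the class-group row, via `ClassGroupRow.classGroupRow_map_eq_zero_iff`);
* §3 ★ `exists_iota_eq_two_nsmul` — for `S = supp(p𝔣)` (`𝔣 ≠ 0`), `N_S ≤ V_n`, `N_S ≤ ker (ℤ/p^k)(θ)`, `N_S` trivial on `(F/𝓞)(θ)`, every
  `v ∈ S` with `v ∤ p` carrying an inertia element of `Gal(K̄/K̃_∞)` on which `unitChar θ = −1` (exact tame conductor), `K` totally complex: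
  every `s` unramified away from `p` and STRICT above `p` satisfies `ι_{n,k}(z) = 2·s` for some layer class `z ∈ Ш¹_S(K̃_n, (ℤ/p^k)(θ))`
  (`shaOne`).  With `ClassGroupRow.classGroupRow_map_eq_zero_iff` this is the hypothesis `hfker` (with `r = 2`) of the descent lemma for the
  class-group row `Φ`.

HONEST FRAMING: no BSD, no main conjecture; no summit statement is proved by this seat.

## References
* J. Johnson-Leung, G. Kings (2011), §5.4 Lemma 5.8 (arXiv p0015:L150–165). [JohnsonLeungKings2011]
* J.-P. Serre, *Galois Cohomology* (1997), I §2.2 Prop. 8. [SerreGaloisCohomology1997]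
* J. S. Milne, *Arithmetic Duality Theorems* (2006), I §4 (p. 56). [MilneADT2006]
-/

noncomputable section

open scoped NumberField
open CategoryTheory Field IsDedekindDomain
open Literature.NumberTheory.GaloisRepresentations
open Literature.NumberTheory.GaloisRepresentations.DiscreteGaloisModule
open Literature.NumberTheory.GaloisCohomology Literature.NumberTheory.GaloisCohomology.ShaLayer
open Literature.NumberTheory.EllipticCurves Literature.NumberTheory.EllipticCurves.KellerYin2024
open Literature.NumberTheory.EllipticCurves.GreenbergSelmer Literature.NumberTheory.EllipticCurves.GreenbergVatsal2000

namespace Literature.NumberTheory.ComplexMultiplication.EllipticUnits.JohnsonLeungKings2011.ClassGroupRow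

variable {K : Type} [Field K] [NumberField K] (p : ℕ) [Fact p.Prime]
  (κ₁ κ₂ : ZpExtension K p) (θ : FramedGaloisRep K (padicCoeffIntegers (∅ : Set (PadicAlgCl p))) 1) (𝔣 : Ideal (𝓞 K))

/-! ## §1 The local tower at a finite place -/

omit [NumberField K] in
/-- `π x ∈ π(V)` and `N_S ≤ V` ⟹ `x ∈ V`. [cite: SerreGaloisCohomology1997, I §2.2] -/
theorem mem_of_toUnramifiedQuot_mem_map {S : Set (HeightOneSpectrum (𝓞 K))} {V : Subgroup (absoluteGaloisGroup K)}
    (hVS : ramificationSubgroup K S ≤ V) {x : absoluteGaloisGroup K}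
    (hx : toUnramifiedQuot K S x ∈ V.map (toUnramifiedQuot K S)) : x ∈ V := by
  obtain ⟨y, hy, hyx⟩ := Subgroup.mem_map.mp hx
  obtain ⟨z, hz, hzz⟩ := (QuotientGroup.mk'_eq_mk' _).mp hyx
  rw [← hzz]
  exact V.mul_mem hy (hVS hz)

/-- **Cofinality of the local tower**: every open `W ⊆ Γ_{K_v}` containing `Λ_∞ = res_v⁻¹ Gal(K̄/K̃_∞)` contains some `Λ_m = φ_v⁻¹ V̄_m`.
[cite: SerreGaloisCohomology1997, I §2.2 Prop. 8] -/
theorem exists_localLayer_subset (hV : ∀ m : ℕ, ramificationSubgroup K (suppPF p 𝔣) ≤ pairLayerSubgroup κ₁ κ₂ m)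
    (v : HeightOneSpectrum (𝓞 K)) {W : Set (absoluteGaloisGroup (v.adicCompletion K))} (hW : IsOpen W)
    (hHW : ((ZpExtension.pairKer κ₁ κ₂).comap (absGaloisRestrict K (v.adicCompletion K)).toMonoidHom : Set _) ⊆ W) :
    ∃ m : ℕ, ((((pairLayerSubgroup κ₁ κ₂ m).map (toUnramifiedQuot K (suppPF p 𝔣))).comap
      (locHom (S := suppPF p 𝔣) v : absoluteGaloisGroup (v.adicCompletion K) →* GaloisGroupUnramifiedOutside K (suppPF p 𝔣)) :
        Subgroup (absoluteGaloisGroup (v.adicCompletion K))) : Set _) ⊆ W := by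
  haveI := absoluteGaloisGroup_compactSpace (v.adicCompletion K)
  refine SubgroupH1Colimit.exists_coe_subset_of_antitone
    (fun m => ((pairLayerSubgroup κ₁ κ₂ m).map (toUnramifiedQuot K (suppPF p 𝔣))).comap
      (locHom (S := suppPF p 𝔣) v : absoluteGaloisGroup (v.adicCompletion K) →* GaloisGroupUnramifiedOutside K (suppPF p 𝔣)))
    (fun m => (isOpen_map_toUnramifiedQuot (suppPF p 𝔣) _ (isOpen_pairLayerSubgroup κ₁ κ₂ m)).preimage (locHom (S := suppPF p 𝔣) v).continuous_toFun)
    (fun _ _ h => Subgroup.comap_mono (Subgroup.map_mono (pairLayerSubgroup_antitone κ₁ κ₂ h))) (fun g hg => ?_) hW hHW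
  refine Subgroup.mem_comap.mpr (mem_pairKer_of_forall_mem_pairLayerSubgroup p κ₁ κ₂ fun m => ?_)
  exact mem_of_toUnramifiedQuot_mem_map (hV m) (Subgroup.mem_comap.mp (hg m))

/-- The stabilisers of the local representation `(ℤ/p^k)(θ)^{N_S}|_{Γ_{K_v}}` are open. [cite: SerreGaloisCohomology1997, I §2.1] -/
theorem isOpen_setOf_locRep_apply_eq (v : HeightOneSpectrum (𝓞 K)) (k : ℕ)
    (w : TopRep.res (locHom (S := suppPF p 𝔣) v : absoluteGaloisGroup (v.adicCompletion K) →* GaloisGroupUnramifiedOutside K (suppPF p 𝔣))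
      ((zmodTwist p (unitChar θ) k).quotientInvariants (ramificationSubgroup K (suppPF p 𝔣))).toTopRep) :
    IsOpen {g : absoluteGaloisGroup (v.adicCompletion K) |
      (TopRep.res (locHom (S := suppPF p 𝔣) v : absoluteGaloisGroup (v.adicCompletion K) →* GaloisGroupUnramifiedOutside K (suppPF p 𝔣))
        ((zmodTwist p (unitChar θ) k).quotientInvariants (ramificationSubgroup K (suppPF p 𝔣))).toTopRep).ρ g w = w} :=
  (ContinuousRep.isOpen_setOf_apply_eq ((zmodTwist p (unitChar θ) k).quotientInvariants (ramificationSubgroup K (suppPF p 𝔣))) w).preimage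
    (locHom (S := suppPF p 𝔣) v).continuous_toFun

/-- Transitivity of the local restrictions `Λ_N ≤ Λ_{n'} ≤ Λ_n`. [cite: SerreGaloisCohomology1997, I §2.4] -/
theorem SubgroupRepColimit_resLe_resLe (v : HeightOneSpectrum (𝓞 K)) (k : ℕ) {n n' N : ℕ} (hn' : n ≤ n') (hN : n' ≤ N)
    (y : continuousCohomology 1 (subgroupRep
      (TopRep.res (locHom (S := suppPF p 𝔣) v : absoluteGaloisGroup (v.adicCompletion K) →* GaloisGroupUnramifiedOutside K (suppPF p 𝔣))
        ((zmodTwist p (unitChar θ) k).quotientInvariants (ramificationSubgroup K (suppPF p 𝔣))).toTopRep)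
      (((pairLayerSubgroup κ₁ κ₂ n).map (toUnramifiedQuot K (suppPF p 𝔣))).comap
        (locHom (S := suppPF p 𝔣) v : absoluteGaloisGroup (v.adicCompletion K) →* GaloisGroupUnramifiedOutside K (suppPF p 𝔣))))) :
    resLe (TopRep.res (locHom (S := suppPF p 𝔣) v : absoluteGaloisGroup (v.adicCompletion K) →* GaloisGroupUnramifiedOutside K (suppPF p 𝔣))
          ((zmodTwist p (unitChar θ) k).quotientInvariants (ramificationSubgroup K (suppPF p 𝔣))).toTopRep)
        (Subgroup.comap_mono (Subgroup.map_mono (pairLayerSubgroup_antitone κ₁ κ₂ hN)) :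
          ((pairLayerSubgroup κ₁ κ₂ N).map (toUnramifiedQuot K (suppPF p 𝔣))).comap (locHom (S := suppPF p 𝔣) v : _ →* _) ≤
            ((pairLayerSubgroup κ₁ κ₂ n').map (toUnramifiedQuot K (suppPF p 𝔣))).comap (locHom (S := suppPF p 𝔣) v : _ →* _)) 1
      (resLe (TopRep.res (locHom (S := suppPF p 𝔣) v : absoluteGaloisGroup (v.adicCompletion K) →* GaloisGroupUnramifiedOutside K (suppPF p 𝔣))
          ((zmodTwist p (unitChar θ) k).quotientInvariants (ramificationSubgroup K (suppPF p 𝔣))).toTopRep)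
        (Subgroup.comap_mono (Subgroup.map_mono (pairLayerSubgroup_antitone κ₁ κ₂ hn')) :
          ((pairLayerSubgroup κ₁ κ₂ n').map (toUnramifiedQuot K (suppPF p 𝔣))).comap (locHom (S := suppPF p 𝔣) v : _ →* _) ≤
            ((pairLayerSubgroup κ₁ κ₂ n).map (toUnramifiedQuot K (suppPF p 𝔣))).comap (locHom (S := suppPF p 𝔣) v : _ →* _)) 1 y) =
      resLe (TopRep.res (locHom (S := suppPF p 𝔣) v : absoluteGaloisGroup (v.adicCompletion K) →* GaloisGroupUnramifiedOutside K (suppPF p 𝔣))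
          ((zmodTwist p (unitChar θ) k).quotientInvariants (ramificationSubgroup K (suppPF p 𝔣))).toTopRep)
        (Subgroup.comap_mono (Subgroup.map_mono (pairLayerSubgroup_antitone κ₁ κ₂ (hn'.trans hN))) :
          ((pairLayerSubgroup κ₁ κ₂ N).map (toUnramifiedQuot K (suppPF p 𝔣))).comap (locHom (S := suppPF p 𝔣) v : _ →* _) ≤
            ((pairLayerSubgroup κ₁ κ₂ n).map (toUnramifiedQuot K (suppPF p 𝔣))).comap (locHom (S := suppPF p 𝔣) v : _ →* _)) 1 y :=
  resLe_resLe_apply _ _ _ y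

/-- **The local colimit step**: a local layer class at `Λ_n` dying on `Λ_∞` dies on some deeper local layer `Λ_{n'}`.
[cite: SerreGaloisCohomology1997, I §2.2 Prop. 8] -/
theorem exists_resLe_loc_eq_zero (hV : ∀ m : ℕ, ramificationSubgroup K (suppPF p 𝔣) ≤ pairLayerSubgroup κ₁ κ₂ m)
    (v : HeightOneSpectrum (𝓞 K)) (k n : ℕ)
    (y : continuousCohomology 1 (subgroupRep
      (TopRep.res (locHom (S := suppPF p 𝔣) v : absoluteGaloisGroup (v.adicCompletion K) →* GaloisGroupUnramifiedOutside K (suppPF p 𝔣))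
        ((zmodTwist p (unitChar θ) k).quotientInvariants (ramificationSubgroup K (suppPF p 𝔣))).toTopRep)
      (((pairLayerSubgroup κ₁ κ₂ n).map (toUnramifiedQuot K (suppPF p 𝔣))).comap
        (locHom (S := suppPF p 𝔣) v : absoluteGaloisGroup (v.adicCompletion K) →* GaloisGroupUnramifiedOutside K (suppPF p 𝔣)))))
    (hy : resLe _ (comap_absGaloisRestrict_le_comap_locHom (suppPF p 𝔣) (pairKer_le_pairLayerSubgroup κ₁ κ₂ n) v) 1 y = 0) :
    ∃ n', n ≤ n' ∧ ∀ (N : ℕ) (hN : n ≤ N), n' ≤ N → resLe (TopRep.res (locHom (S := suppPF p 𝔣) v : absoluteGaloisGroup (v.adicCompletion K) →*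
          GaloisGroupUnramifiedOutside K (suppPF p 𝔣)) ((zmodTwist p (unitChar θ) k).quotientInvariants (ramificationSubgroup K (suppPF p 𝔣))).toTopRep)
        (Subgroup.comap_mono (Subgroup.map_mono (pairLayerSubgroup_antitone κ₁ κ₂ hN)) :
          ((pairLayerSubgroup κ₁ κ₂ N).map (toUnramifiedQuot K (suppPF p 𝔣))).comap (locHom (S := suppPF p 𝔣) v : _ →* _) ≤
            ((pairLayerSubgroup κ₁ κ₂ n).map (toUnramifiedQuot K (suppPF p 𝔣))).comap (locHom (S := suppPF p 𝔣) v : _ →* _)) 1 y = 0 := by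
  obtain ⟨n', hn', h0⟩ := SubgroupRepColimit.exists_resLe_eq_zero _ (isOpen_setOf_locRep_apply_eq p θ 𝔣 v k)
    (fun m => ((pairLayerSubgroup κ₁ κ₂ m).map (toUnramifiedQuot K (suppPF p 𝔣))).comap
      (locHom (S := suppPF p 𝔣) v : absoluteGaloisGroup (v.adicCompletion K) →* GaloisGroupUnramifiedOutside K (suppPF p 𝔣)))
    (fun m => (isOpen_map_toUnramifiedQuot (suppPF p 𝔣) _ (isOpen_pairLayerSubgroup κ₁ κ₂ m)).preimage (locHom (S := suppPF p 𝔣) v).continuous_toFun)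
    (fun m => comap_absGaloisRestrict_le_comap_locHom (suppPF p 𝔣) (pairKer_le_pairLayerSubgroup κ₁ κ₂ m) v)
    (fun _ _ h => Subgroup.comap_mono (Subgroup.map_mono (pairLayerSubgroup_antitone κ₁ κ₂ h)))
    (fun _ hW hHW => exists_localLayer_subset p κ₁ κ₂ 𝔣 hV v hW hHW) y hy
  refine ⟨n', hn', fun N hN hn'N => ?_⟩
  have h := SubgroupRepColimit_resLe_resLe p κ₁ κ₂ θ 𝔣 v k hn' hn'N y
  rw [h0, map_zero] at h
  exact h.symm

/-! ## §2 The comparison image of a descended cocycle -/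

omit [NumberField K] in
/-- `toSubgroupH1 [z] = res^{V_n}_{K̃_∞} [c]` for a layer cocycle `z` descended from `c` (`e (z (π w)) = c w`).
[cite: JohnsonLeungKings2011, §5.4 Lemma 5.8] [cite: SerreGaloisCohomology1997, I §2.4] -/
theorem toSubgroupH1_eq_resOfLe_of_descend (n k : ℕ)
    (c : contOneCocycles (discreteTopRep (↥(pairLayerSubgroup κ₁ κ₂ n)) (charModule (∅ : Set (PadicAlgCl p)) θ)))
    (z : contOneCocycles (subgroupRep (((zmodTwist p (unitChar θ) k).quotientInvariants
        (ramificationSubgroup K (suppPF p 𝔣))).toTopRep) ((pairLayerSubgroup κ₁ κ₂ n).map (toUnramifiedQuot K (suppPF p 𝔣)))))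
    (hz : ∀ w : pairLayerSubgroup κ₁ κ₂ n, zmodToCharModule θ k ((z.1 ⟨toUnramifiedQuot K (suppPF p 𝔣) w, Subgroup.mem_map_of_mem _ w.2⟩ :
        Representation.invariants ((zmodTwist p (unitChar θ) k).toRepresentation.comp (ramificationSubgroup K (suppPF p 𝔣)).subtype)) :
          ZMod (p ^ k)) = c.1 w) :
    toSubgroupH1 (suppPF p 𝔣) (zmodTwist p (unitChar θ) k) (zmodToCharModule θ k) (zmodToCharModule_equivariant p θ k)
        (pairKer_le_pairLayerSubgroup κ₁ κ₂ n) (oneCocycleClass _ z) =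
      resOfLe _ (pairKer_le_pairLayerSubgroup κ₁ κ₂ n) (oneCocycleClass _ c) := by
  rw [toSubgroupH1_oneCocycleClass]
  have hres : resOfLe _ (pairKer_le_pairLayerSubgroup κ₁ κ₂ n) (oneCocycleClass _ c) =
      oneCocycleClass _ (contOneCocycles.pullback (subgroupInclusion (pairKer_le_pairLayerSubgroup κ₁ κ₂ n))
        (resHomOfEquivariant (subgroupInclusion (pairKer_le_pairLayerSubgroup κ₁ κ₂ n)) (AddMonoidHom.id _) (fun _ _ ↦ rfl)) c) :=
    map_oneCocycleClass _ _ _ c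
  rw [hres]
  refine congrArg (oneCocycleClass _) (Subtype.ext (ContinuousMap.ext fun h => ?_))
  rw [pullback_toLayerGroup_apply]
  exact hz (Subgroup.inclusion (pairKer_le_pairLayerSubgroup κ₁ κ₂ n) h)

/-! ## §3 The assembly -/

/-- `supp(p𝔣)` is finite for `𝔣 ≠ 0`. [cite: JohnsonLeungKings2011, §4.1] -/
theorem finite_suppPF (h𝔣 : 𝔣 ≠ 0) : (suppPF p 𝔣).Finite := by
  refine Ideal.finite_factors ?_
  refine mul_ne_zero ?_ h𝔣
  rw [Ne, Ideal.zero_eq_bot, Ideal.span_singleton_eq_bot]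
  exact_mod_cast (Fact.out : p.Prime).ne_zero

set_option maxHeartbeats 1600000 in
/-- **PLUG (π3) — `2·s ∈ ι_{n,k}(Ш¹_S(K̃_n, (ℤ/p^k)(θ)))`.**  See the module docstring for the hypotheses.  Proof: group + coefficient
steps (`…ClassGroupRowLayers`), local coboundary data for the finitely many pairs (place of `S`, coset of `Γ_K ⧸ V_n`)
(`…ClassGroupRowLocal`), the local colimits (§1) for a common deeper layer `N`, conjugations indexed by `Γ_K ⧸ V_n`
(`layerConj_eq_self_of_mem`, `layerConj_resLe`, `layerLocalization_inr_resLe`), complex places trivial.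
[cite: JohnsonLeungKings2011, §5.4 Lemma 5.8 (arXiv p0015:L150–165)] [cite: MilneADT2006, I §4 (p. 56)] [cite: SerreGaloisCohomology1997, I §2.2 Prop. 8] -/
theorem exists_iota_eq_two_nsmul (h𝔣 : 𝔣 ≠ 0)
    (hV : ∀ n : ℕ, ramificationSubgroup K (suppPF p 𝔣) ≤ pairLayerSubgroup κ₁ κ₂ n)
    (hZ : ∀ k : ℕ, ramificationSubgroup K (suppPF p 𝔣) ≤ ContinuousRep.ker (zmodTwist p (unitChar θ) k))
    (hMN : ∀ σ ∈ ramificationSubgroup K (suppPF p 𝔣), ∀ m : charModule (∅ : Set (PadicAlgCl p)) θ, σ • m = m)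
    (hram : ∀ v ∈ suppPF p 𝔣, ((p : ℕ) : 𝓞 K) ∉ v.asIdeal → ∃ i₀ ∈ absInertia (v.adicCompletion K),
      absGaloisRestrict K (v.adicCompletion K) i₀ ∈ ZpExtension.pairKer κ₁ κ₂ ∧ unitChar θ (absGaloisRestrict K (v.adicCompletion K) i₀) = -1)
    (hcx : ∀ w : NumberField.InfinitePlace K, w.IsComplex)
    (s : subgroupH1 (ZpExtension.pairKer κ₁ κ₂) (charModule (∅ : Set (PadicAlgCl p)) θ))
    (hs : s ∈ unramifiedOutside (ZpExtension.pairKer κ₁ κ₂) (charModule (∅ : Set (PadicAlgCl p)) θ) p ∅)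
    (hst : ∀ v : HeightOneSpectrum (𝓞 K), ((p : ℕ) : 𝓞 K) ∈ v.asIdeal → ∀ τ : absoluteGaloisGroup K,
      conjH1 (ZpExtension.pairKer κ₁ κ₂) _ τ s ∈
        (Castella2018.AcSelmer.strictDatum (charModule (∅ : Set (PadicAlgCl p)) θ) v).strictKer (ZpExtension.pairKer κ₁ κ₂)) :
    ∃ (n k : ℕ) (z : shaOne p κ₁ κ₂ θ 𝔣 n k),
      ((iota p κ₁ κ₂ θ 𝔣 n k z : unrEverywhere₂ κ₁ κ₂ (charModule (∅ : Set (PadicAlgCl p)) θ)) :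
        subgroupH1 (ZpExtension.pairKer κ₁ κ₂) (charModule (∅ : Set (PadicAlgCl p)) θ)) = 2 • s := by
  classical
  -- (0) the ramification subgroup lies in `Gal(K̄/K̃_∞)`
  have hHS : ramificationSubgroup K (suppPF p 𝔣) ≤ ZpExtension.pairKer κ₁ κ₂ := fun g hg =>
    mem_pairKer_of_forall_mem_pairLayerSubgroup p κ₁ κ₂ fun n => hV n hg
  -- (1) group step
  obtain ⟨n, c, hcs, hcN⟩ := exists_cocycle_layer_of_mem_unramifiedOutside (suppPF p 𝔣) ∅ p (Set.empty_subset _)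
    (fun v hv => mem_suppPF_of_mem p 𝔣 v hv) (fun m => GreenbergSelmer.isOpen_stabilizer_cofree _ θ m) hMN
    (ZpExtension.pairKer κ₁ κ₂) (TwoVariableSelmer.isClosed_pairKer κ₁ κ₂) hHS (pairLayerSubgroup κ₁ κ₂)
    (isOpen_pairLayerSubgroup κ₁ κ₂) (pairKer_le_pairLayerSubgroup κ₁ κ₂)
    (fun V hVo hKV => exists_pairLayerSubgroup_subset p κ₁ κ₂ hVo hKV) s hs
  -- (2) the finite index set: places of `S` × cosets of `V_n`
  haveI := finiteIndex_pairLayerSubgroup p κ₁ κ₂ n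
  haveI : Finite (suppPF p 𝔣) := (finite_suppPF p 𝔣 h𝔣).to_subtype
  let ι : Type := (suppPF p 𝔣) × (absoluteGaloisGroup K ⧸ pairLayerSubgroup κ₁ κ₂ n)
  haveI : Finite ι := Finite.instProd
  -- (3) local coboundary data
  have hdata : ∀ i : ι, ∃ a : charModule (∅ : Set (PadicAlgCl p)) θ,
      (((p : ℕ) : 𝓞 K) ∈ i.1.1.asIdeal → ∀ (x : absoluteGaloisGroup K), x ∈ ZpExtension.pairKer κ₁ κ₂ → x ∈ decomp (K := K) i.1.1 →
        ∀ hm : (i.2.out)⁻¹ * x * i.2.out ∈ pairLayerSubgroup κ₁ κ₂ n, i.2.out • c.1 ⟨(i.2.out)⁻¹ * x * i.2.out, hm⟩ = x • a - a) ∧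
      (((p : ℕ) : 𝓞 K) ∉ i.1.1.asIdeal → ∀ (x : absoluteGaloisGroup K), x ∈ ZpExtension.pairKer κ₁ κ₂ →
        x ∈ GreenbergSelmer.inertia (K := K) i.1.1 →
        ∀ hm : (i.2.out)⁻¹ * x * i.2.out ∈ pairLayerSubgroup κ₁ κ₂ n, i.2.out • c.1 ⟨(i.2.out)⁻¹ * x * i.2.out, hm⟩ = x • a - a) := by
    intro i
    by_cases hp : ((p : ℕ) : 𝓞 K) ∈ i.1.1.asIdeal
    · obtain ⟨a, ha⟩ := exists_coboundary_of_mem_strictKer p κ₁ κ₂ θ n c s hcs i.1.1 i.2.out (hst i.1.1 hp i.2.out)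
      exact ⟨a, fun _ => ha, fun h => absurd hp h⟩
    · obtain ⟨a, ha⟩ := exists_coboundary_of_mem_unramifiedKer p κ₁ κ₂ θ n c s hcs i.1.1 i.2.out
        ((mem_unramifiedOutside_iff _).mp hs i.1.1 (Set.notMem_empty _) hp i.2.out)
      exact ⟨a, fun h => absurd h hp, fun _ => ha⟩
  choose a ha using hdata
  -- (4) the level `k`
  obtain ⟨k₀, hk₀⟩ := exists_forall_mem_range_zmodToCharModule p θ
    ((pairLayerSubgroup κ₁ κ₂ n).isClosed_of_isOpen (isOpen_pairLayerSubgroup κ₁ κ₂ n)) c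
  obtain ⟨k₁, hk₁⟩ := exists_forall_mem_range_zmodToCharModule_of_finite p θ a
  set k := max k₀ k₁ with hk
  have ha' : ∀ i : ι, ∃ a' : ZMod (p ^ k), zmodToCharModule θ k a' = a i := fun i => hk₁ k (le_max_right _ _) i
  choose a' ha' using ha'
  -- (5) descent to the layer `V̄_n` with coefficients `(ℤ/p^k)(θ)`
  obtain ⟨z, hz⟩ := exists_cocycle_descend (suppPF p 𝔣) (zmodTwist p (unitChar θ) k) (zmodToCharModule θ k)
    (zmodToCharModule_equivariant p θ k) (isOpen_pairLayerSubgroup κ₁ κ₂ n) (hV n) (hZ k) (zmodToCharModule_injective θ k) c hcN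
    (hk₀ k (le_max_left _ _))
  -- the local classes `y i` at `Λ_n` and their vanishing on `Λ_∞`
  have hy0 : ∀ i : ι,
      resLe (TopRep.res (locHom (S := suppPF p 𝔣) i.1.1 : absoluteGaloisGroup (i.1.1.adicCompletion K) →*
            GaloisGroupUnramifiedOutside K (suppPF p 𝔣)) ((zmodTwist p (unitChar θ) k).quotientInvariants (ramificationSubgroup K (suppPF p 𝔣))).toTopRep)
          (comap_absGaloisRestrict_le_comap_locHom (suppPF p 𝔣) (pairKer_le_pairLayerSubgroup κ₁ κ₂ n) i.1.1) 1
        (layerLocalization (suppPF p 𝔣) (zmodTwist p (unitChar θ) k) (pairLayerSubgroup κ₁ κ₂ n) (Sum.inr i.1.1) 1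
          (ShaLayer.layerConj (suppPF p 𝔣) (zmodTwist p (unitChar θ) k) (pairLayerSubgroup κ₁ κ₂ n) (toUnramifiedQuot K (suppPF p 𝔣) i.2.out) 1
            (oneCocycleClass _ z + oneCocycleClass _ z))) = 0 := by
    intro i
    rw [map_add, map_add]
    erw [map_add]
    by_cases hp : ((p : ℕ) : 𝓞 K) ∈ i.1.1.asIdeal
    · have h := resLe_loc_conj_eq_zero_of_coboundary p κ₁ κ₂ θ 𝔣 n k c z hz i.1.1 i.2.out (ha' i) ((ha i).1 hp) (hZ k)
      have h' : resLe (TopRep.res (locHom (S := suppPF p 𝔣) i.1.1 : absoluteGaloisGroup (i.1.1.adicCompletion K) →*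
            GaloisGroupUnramifiedOutside K (suppPF p 𝔣)) ((zmodTwist p (unitChar θ) k).quotientInvariants (ramificationSubgroup K (suppPF p 𝔣))).toTopRep)
          (comap_absGaloisRestrict_le_comap_locHom (suppPF p 𝔣) (pairKer_le_pairLayerSubgroup κ₁ κ₂ n) i.1.1) 1
          (layerLocalization (suppPF p 𝔣) (zmodTwist p (unitChar θ) k) (pairLayerSubgroup κ₁ κ₂ n) (Sum.inr i.1.1) 1
            (ShaLayer.layerConj (suppPF p 𝔣) (zmodTwist p (unitChar θ) k) (pairLayerSubgroup κ₁ κ₂ n) (toUnramifiedQuot K (suppPF p 𝔣) i.2.out) 1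
              (oneCocycleClass _ z))) = 0 := h
      rw [h', add_zero]
    · obtain ⟨i₀, hi₀, hi₀H, hθi₀⟩ := hram i.1.1 i.1.2 hp
      have h := two_nsmul_resLe_loc_conj_eq_zero_of_coboundary p κ₁ κ₂ θ 𝔣 n k c z hz i.1.1 i.2.out (ha' i) ((ha i).2 hp) (hZ k)
        i₀ hi₀ hi₀H hθi₀
      rw [two_nsmul] at h
      exact h
  -- (6) the local colimits and a common deeper layer `N`
  have hcol := fun i : ι => exists_resLe_loc_eq_zero p κ₁ κ₂ θ 𝔣 hV i.1.1 k n _ (hy0 i)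
  choose nf hnf hmono using hcol
  haveI : Fintype ι := Fintype.ofFinite ι
  set N := max n (Finset.univ.sup nf) with hN
  have hnN : n ≤ N := le_max_left _ _
  have hNi : ∀ i : ι, nf i ≤ N := fun i => (Finset.le_sup (Finset.mem_univ i)).trans (le_max_right _ _)
  -- (7) the class at layer `N`
  set zN := (resLe ((zmodTwist p (unitChar θ) k).quotientInvariants (ramificationSubgroup K (suppPF p 𝔣))).toTopRep
    (Subgroup.map_mono (pairLayerSubgroup_antitone κ₁ κ₂ hnN) :
      (pairLayerSubgroup κ₁ κ₂ N).map (toUnramifiedQuot K (suppPF p 𝔣)) ≤ (pairLayerSubgroup κ₁ κ₂ n).map (toUnramifiedQuot K (suppPF p 𝔣))) 1).hom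
    (oneCocycleClass _ z + oneCocycleClass _ z) with hzN
  have hmem : zN ∈ shaOne p κ₁ κ₂ θ 𝔣 N k := by
    refine (mem_layerShaRestricted_iff (suppPF p 𝔣) (zmodTwist p (unitChar θ) k) (pairLayerSubgroup κ₁ κ₂ N) 1 zN).mpr ⟨fun w σ => ?_, fun v hv σ => ?_⟩
    · exact layerLocalization_inl_eq_zero (suppPF p 𝔣) (zmodTwist p (unitChar θ) k) (hcx w) _
    · obtain ⟨τ₀, rfl⟩ := toUnramifiedQuot_surjective K (suppPF p 𝔣) σ
      let q : absoluteGaloisGroup K ⧸ pairLayerSubgroup κ₁ κ₂ n := τ₀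
      let i : ι := (⟨v, hv⟩, q)
      have hν : (i.2.out)⁻¹ * τ₀ ∈ pairLayerSubgroup κ₁ κ₂ n := QuotientGroup.eq.mp (QuotientGroup.out_eq' q)
      have hσ : toUnramifiedQuot K (suppPF p 𝔣) τ₀ =
          toUnramifiedQuot K (suppPF p 𝔣) i.2.out * toUnramifiedQuot K (suppPF p 𝔣) ((i.2.out)⁻¹ * τ₀) := by
        rw [← map_mul, mul_inv_cancel_left]
      rw [hσ, layerConj_mul, hzN, layerConj_resLe (suppPF p 𝔣) (zmodTwist p (unitChar θ) k) (pairLayerSubgroup_antitone κ₁ κ₂ hnN),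
        layerConj_eq_self_of_mem (suppPF p 𝔣) _ (Subgroup.mem_map_of_mem _ hν),
        layerConj_resLe (suppPF p 𝔣) (zmodTwist p (unitChar θ) k) (pairLayerSubgroup_antitone κ₁ κ₂ hnN),
        layerLocalization_inr_resLe (suppPF p 𝔣) (zmodTwist p (unitChar θ) k) (pairLayerSubgroup_antitone κ₁ κ₂ hnN)]
      -- `= res^{Λ_n}_{Λ_N} (y i) = 0` by the choice of `N ≥ nf i`
      exact hmono i N hnN (hNi i)
  refine ⟨N, k, ⟨zN, hmem⟩, ?_⟩
  -- (8) the comparison image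
  rw [coe_iota]
  change toSubgroupH1 (suppPF p 𝔣) (zmodTwist p (unitChar θ) k) (zmodToCharModule θ k) (zmodToCharModule_equivariant p θ k)
      (pairKer_le_pairLayerSubgroup κ₁ κ₂ N) zN = 2 • s
  rw [hzN, toSubgroupH1_resLe (suppPF p 𝔣) (zmodTwist p (unitChar θ) k) (zmodToCharModule θ k) (zmodToCharModule_equivariant p θ k)
    (pairKer_le_pairLayerSubgroup κ₁ κ₂ N) (pairLayerSubgroup_antitone κ₁ κ₂ hnN), map_add,
    toSubgroupH1_eq_resOfLe_of_descend p κ₁ κ₂ θ 𝔣 n k c z hz, hcs, two_nsmul]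

/-! ## §4 The kernel of the class-group row is killed by `2` -/

/-- **`hfker` for the class-group row, with `r = 2`**: if the character `x ∈ C.X = H¹_{unr}(K̃_∞, (F/𝓞)(θ))^∨` kills every
`ι_{n,k}(Ш¹_S(K̃_n, (ℤ/p^k)(θ)))` (which is `Φ x = 0` for the class-group row `Φ`, `ClassGroupRow.classGroupRow_map_eq_zero_iff`) and
`H¹_{unr} ≤` the strict Selmer group (the DA7 identification), then `2 • x = 0`. [cite: JohnsonLeungKings2011, §5.4 Lemma 5.8 (arXiv p0015:L150–165)] -/
theorem two_nsmul_eq_zero_of_forall_toDual_iota_eq_zero (h𝔣 : 𝔣 ≠ 0)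
    (hV : ∀ n : ℕ, ramificationSubgroup K (suppPF p 𝔣) ≤ pairLayerSubgroup κ₁ κ₂ n)
    (hZ : ∀ k : ℕ, ramificationSubgroup K (suppPF p 𝔣) ≤ ContinuousRep.ker (zmodTwist p (unitChar θ) k))
    (hMN : ∀ σ ∈ ramificationSubgroup K (suppPF p 𝔣), ∀ m : charModule (∅ : Set (PadicAlgCl p)) θ, σ • m = m)
    (hram : ∀ v ∈ suppPF p 𝔣, ((p : ℕ) : 𝓞 K) ∉ v.asIdeal → ∃ i₀ ∈ absInertia (v.adicCompletion K),
      absGaloisRestrict K (v.adicCompletion K) i₀ ∈ ZpExtension.pairKer κ₁ κ₂ ∧ unitChar θ (absGaloisRestrict K (v.adicCompletion K) i₀) = -1)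
    (hcx : ∀ w : NumberField.InfinitePlace K, w.IsComplex)
    (hUS : unrEverywhere₂ κ₁ κ₂ (charModule (∅ : Set (PadicAlgCl p)) θ) ≤
      datumStrictSelmer (ZpExtension.pairKer κ₁ κ₂) (charModule (∅ : Set (PadicAlgCl p)) θ) p
        (fun v _ ↦ Castella2018.AcSelmer.strictDatum (charModule (∅ : Set (PadicAlgCl p)) θ) v) ∅)
    {η₁ η₂ : absoluteGaloisGroup K} (C : ClassGroupDualData₂ κ₁ κ₂ θ η₁ η₂) (x : C.X)
    (hx : ∀ (n k : ℕ) (z : shaOne p κ₁ κ₂ θ 𝔣 n k), C.toDual x (iota p κ₁ κ₂ θ 𝔣 n k z) = 0) :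
    2 • x = 0 := by
  have h2 : C.toDual (2 • x) = 0 := by
    ext s
    obtain ⟨hs, hst⟩ := (mem_datumStrictSelmer_iff _).mp (hUS s.2)
    obtain ⟨n, k, z, hz⟩ := exists_iota_eq_two_nsmul p κ₁ κ₂ θ 𝔣 h𝔣 hV hZ hMN hram hcx _ hs (fun v hv τ => hst v hv τ)
    have hz' : iota p κ₁ κ₂ θ 𝔣 n k z = 2 • s := Subtype.ext (by rw [hz, AddSubgroupClass.coe_nsmul])
    rw [map_nsmul, AddMonoidHom.nsmul_apply, ← map_nsmul, ← hz', hx, AddMonoidHom.zero_apply]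
  exact C.bijective.1 (by rw [h2, map_zero])

end Literature.NumberTheory.ComplexMultiplication.EllipticUnits.JohnsonLeungKings2011.ClassGroupRow

end
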